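import Mathlib
import Summits.QuantumFields.YangMills.Theses.VortexVolumeRatchet
import Literature.MathematicalPhysics.QuantumFieldTheory.TwistedPartitionFunction
import Literature.MathematicalPhysics.QuantumFieldTheory.TwistedPartitionFunctionRPBound
import Literature.MathematicalPhysics.QuantumFieldTheory.TwistedPartitionFunctionMonotoneStrict
import Literature.MathematicalPhysics.QuantumFieldTheory.TomboulisYaffeInequality
import Literature.MathematicalPhysics.QuantumFieldTheory.WilsonPlaquetteUniformFloor
import Literature.MathematicalPhysics.QuantumFieldTheory.StrongCouplingStringTension
import HarnessLib

/-!
# The dyadic vortex-volume ratchet at strong coupling (BC5 rung of route `VortexVolumeRatchet`)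

The registered stub `stub_strongCouplingRatchet : StrongCouplingRatchetP` of the birth skeleton of the crux
`VortexVolumeRatchet.DyadicVolumeRatchet` (item stmt-QuantumFields-23465; critic PRICE P1 «rung before provers»), proved from
the tree alone: for `SU(N)`, `N ≥ 2`, every faithful continuous unitary lattice representation `r`, every central `z ≠ 1`
acting in `r` by a scalar `ω` (`‖ω‖ = 1`, `ω ≠ 1`) and every plane `q`, there is `β₀ = β₀(N, r, z, q) > 0` such that for
`0 < β ≤ β₀` the 't Hooft vortex ratio `t_z(L) = Z_z(L)/Z_1(L)` is eventually non-decreasing along the dyadic sides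
`L = 2^{n+1} ↦ 2^{n+2}`.

Mechanism (two tree inequalities facing each other across ONE doubling):
* FLOOR at side `L = 2^{n+1}`: the Tomboulis–Yaffe plaquette inequality `|⟨W□⟩| ≤ N_r^{2/L}·(8(1 - t_z(L))/‖1-ω‖²)^{1/L²}`
  (`TomboulisYaffe.plaquette_abs_le_twist`) together with the VOLUME-UNIFORM plaquette floor `⟨W□⟩_{L,β} ≥ w(β) :=
  log c_r(β)/(9d²N_rβ) > 0` (`wilsonExpectation_wilsonLoop_one_one_ge_uniform`) gives
  `1 - t_z(L) ≥ ‖1-ω‖²·w(β)^{L²}/(8 N_r^{2L})`;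
* CEILING at side `2L`: the strong-coupling cluster expansion `1 - t_z(2L) ≤ 2d²(2L)^d (c₂β)^{(2L)²}`,
  `c₂ = 4eN_r(8(d-1)+1)²`, for `β ≤ 1/(4N_r(8(d-1)+1)²e²)` (`CentralTwist.one_sub_twistZ_div_twistZ_le_pow` via
  `MultiTwist.twistZ_mulSingle`);
* since `w(β) ≥ c₁β` for `β ≤ 1` (`UniformFloor.one_add_le_plaqNorm`: `c_r(β) ≥ 1 + β²v/2`), for `β ≤ β₀` one has
  `(c₂β)^4 ≤ w(β)/2`, so `ceiling(2L)/floor(L) ≤ 4096 L⁴ N_r^{2L} 2^{-L²}/‖1-ω‖² → 0`: eventually `1 - t_z(2L) ≤ 1 - t_z(L)`.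

No summit is proved here: this is the strong-coupling instance of the crux (`d = 4` lattice units, fixed `β`), a rung.
-/

namespace Summit.QuantumFields.YangMills.Theorems.VortexVolumeRatchet

open MeasureTheory
open Literature.MathematicalPhysics.QuantumFieldTheory Literature.MathematicalPhysics.QuantumLattice

/-- The registered stub's statement, letter for letter (birth skeleton rev 2 of stmt-QuantumFields-23465, namespace
`Summit.QuantumFields.YangMills.Theses.VortexVolumeRatchetBirthK2`, stub `stub_strongCouplingRatchet : StrongCouplingRatchetP`):
the dyadic 't Hooft-ratio ratchet `t_z(2^{n+1}) ≤ t_z(2^{n+2})` eventually in `n`, for `0 < β ≤ β₀(N, r, z, q)`, central `z ≠ 1`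
acting by a scalar `ω ≠ 1` in the faithful representation `r` of `SU(N)`, `d = 4`. [problem-side] -/
def StrongCouplingRatchetP : Prop :=
    ∀ N : ℕ, 2 ≤ N → ∀ r : LatticeRep (Matrix.specialUnitaryGroup (Fin N) ℂ),
      ∀ z : Matrix.specialUnitaryGroup (Fin N) ℂ, z ∈ Subgroup.center (Matrix.specialUnitaryGroup (Fin N) ℂ) → z ≠ 1 →
      ∀ ω : ℂ, r.ρ z = ω • (1 : Matrix (Fin r.N) (Fin r.N) ℂ) → ‖ω‖ = 1 → ω ≠ 1 →
      ∀ q : {p : Fin 4 × Fin 4 // p.1 < p.2}, ∃ β₀ : ℝ, 0 < β₀ ∧ ∀ β : ℝ, 0 < β → β ≤ β₀ →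
        ∃ n₀ : ℕ, ∀ n : ℕ, n₀ ≤ n →
          twistedPartitionFunction r.ρ β (2 ^ (n + 1) - 2 + 2) z q / twistedPartitionFunction r.ρ β (2 ^ (n + 1) - 2 + 2) 1 q ≤
          twistedPartitionFunction r.ρ β (2 ^ (n + 2) - 2 + 2) z q / twistedPartitionFunction r.ρ β (2 ^ (n + 2) - 2 + 2) 1 q

section General

variable {N : ℕ} {G : Type*} [Group G] [TopologicalSpace G] [IsTopologicalGroup G] [CompactSpace G]
  [MeasurableSpace G] [BorelSpace G] [SecondCountableTopology G] (ρ : G →* Matrix (Fin N) (Fin N) ℂ)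

/-- The dyadic side in the route's spelling is `2^{n+1}`. [problem-side] -/
theorem side_eq (n : ℕ) : 2 ^ (n + 1) - 2 + 2 = 2 ^ (n + 1) := by
  have : 2 ≤ 2 ^ (n + 1) := by
    calc 2 = 2 ^ 1 := by norm_num
      _ ≤ 2 ^ (n + 1) := Nat.pow_le_pow_right (by norm_num) (by omega)
  omega

/-- **Deficit FLOOR at a dyadic side, plane `(0, j)`**: `‖1-ω‖²·w^{L²}/(8N^{2L}) ≤ 1 - Z_z(L)/Z_1(L)` with
`w = log c_ρ(β)/(9·4²·N·β)` the volume-uniform plaquette floor (Tomboulis–Yaffe facing the Gibbs–Jensen floor). [problem-side] -/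
theorem deficit_floor_zero {L : ℕ} [NeZero L] (n : ℕ) (hL : L = 2 ^ (n + 1)) (hN : 1 ≤ N)
    (hρ : Continuous ρ) {z : G} (hz : z ∈ Subgroup.center G) {ω : ℂ}
    (hω : ρ z = ω • (1 : Matrix (Fin N) (Fin N) ℂ)) (hω1 : ‖ω‖ = 1) (hne : ω ≠ 1) {β : ℝ} (hβ : 0 < β)
    {j : Fin 4} (hj : (0 : Fin 4) < j) :
    ‖1 - ω‖ ^ 2 * (Real.log (plaqNorm ρ β (G := G)) / (9 * (4 : ℝ) ^ 2 * N * β)) ^ (L ^ 2) /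
        (8 * (N : ℝ) ^ (2 * L)) ≤
      1 - twistedPartitionFunction (d := 4) ρ β L z ⟨(0, j), hj⟩ /
        twistedPartitionFunction (d := 4) ρ β L 1 ⟨(0, j), hj⟩ := by
  haveI : Fact (1 < L) := ⟨by rw [hL]; exact Nat.one_lt_two_pow (Nat.succ_ne_zero n)⟩
  set w : ℝ := Real.log (plaqNorm ρ β (G := G)) / (9 * (4 : ℝ) ^ 2 * N * β) with hw_def
  set δ : ℝ := 1 - twistedPartitionFunction (d := 4) ρ β L z ⟨(0, j), hj⟩ /
      twistedPartitionFunction (d := 4) ρ β L 1 ⟨(0, j), hj⟩ with hδ_def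
  have hLe : Even L := ⟨2 ^ n, by rw [hL, pow_succ]; ring⟩
  -- positivity of the floor and of the deficit
  have hw_pos : 0 < w := by
    have h := uniformFloor_pos (d := 4) ρ (by norm_num) hN hρ hω hne hβ
    simpa [hw_def] using h
  have hZ1 : 0 < twistedPartitionFunction (d := 4) ρ β L 1 ⟨(0, j), hj⟩ :=
    twistedPartitionFunction_pos ρ hρ β 1 _
  have hδ0 : 0 ≤ δ := by
    have hle := twistedPartitionFunction_le_untwisted_plane ρ β hLe hρ hz (⟨(0, j), hj⟩ : {p : Fin 4 × Fin 4 // p.1 < p.2})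
    have : twistedPartitionFunction (d := 4) ρ β L z ⟨(0, j), hj⟩ /
        twistedPartitionFunction (d := 4) ρ β L 1 ⟨(0, j), hj⟩ ≤ 1 := (div_le_one hZ1).2 hle
    simp only [hδ_def]; linarith
  have hc : 0 < ‖1 - ω‖ ^ 2 := by
    have : (1 : ℂ) - ω ≠ 0 := sub_ne_zero.2 (Ne.symm hne)
    positivity
  -- the two tree inequalities
  have hfloor : w ≤ wilsonExpectation ρ β (wilsonLoop ρ (0 : Site 4 L) 0 j 1 1) := by
    have h := wilsonExpectation_wilsonLoop_one_one_ge_uniform (d := 4) (L := L) ρ (by norm_num) hN hρ hz hω hne hβ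
      (0 : Site 4 L) (ne_of_lt hj)
    simpa [hw_def] using h
  have hTY := TomboulisYaffe.plaquette_abs_le_twist ρ n hL hρ β hj hz hω hω1 hne
  -- chain: w ≤ N^{2/L} (8δ/c)^{1/L²}
  set A : ℝ := (N : ℝ) ^ ((2 : ℝ) / L) with hA_def
  set B : ℝ := 8 * δ / ‖1 - ω‖ ^ 2 with hB_def
  have hB0 : 0 ≤ B := by positivity
  have hN0 : (0 : ℝ) ≤ N := Nat.cast_nonneg _
  have hA0 : 0 ≤ A := Real.rpow_nonneg hN0 _
  have hchain : w ≤ A * B ^ ((1 : ℝ) / (L : ℝ) ^ 2) := by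
    refine hfloor.trans ((le_abs_self _).trans ?_)
    simpa [hA_def, hB_def, hδ_def] using hTY
  -- raise to the power L²
  have hpow := pow_le_pow_left₀ hw_pos.le hchain (L ^ 2)
  have hL0 : (L : ℝ) ≠ 0 := Nat.cast_ne_zero.2 (NeZero.ne L)
  have hBpow : (B ^ ((1 : ℝ) / (L : ℝ) ^ 2)) ^ (L ^ 2) = B := by
    rw [← Real.rpow_natCast, ← Real.rpow_mul hB0]
    have : (1 : ℝ) / (L : ℝ) ^ 2 * ((L ^ 2 : ℕ) : ℝ) = 1 := by
      push_cast; field_simp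
    rw [this, Real.rpow_one]
  have hApow : A ^ (L ^ 2) = (N : ℝ) ^ (2 * L) := by
    rw [hA_def, ← Real.rpow_natCast, ← Real.rpow_mul hN0]
    have : (2 : ℝ) / L * ((L ^ 2 : ℕ) : ℝ) = ((2 * L : ℕ) : ℝ) := by
      push_cast; field_simp
    rw [this, Real.rpow_natCast]
  rw [mul_pow, hBpow, hApow] at hpow
  -- hpow : w ^ (L^2) ≤ N^(2L) * (8 δ / c)
  have hNL : 0 < (N : ℝ) ^ (2 * L) := by
    have : (0 : ℝ) < N := by exact_mod_cast hN
    positivity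
  have h2 : ‖1 - ω‖ ^ 2 * w ^ (L ^ 2) ≤ 8 * (N : ℝ) ^ (2 * L) * δ := by
    have := mul_le_mul_of_nonneg_left hpow hc.le
    have hc0 : ‖1 - ω‖ ^ 2 ≠ 0 := hc.ne'
    have e : ‖1 - ω‖ ^ 2 * ((N : ℝ) ^ (2 * L) * (8 * δ / ‖1 - ω‖ ^ 2)) = 8 * (N : ℝ) ^ (2 * L) * δ := by
      rw [mul_div_assoc', mul_div_assoc', mul_comm (‖1 - ω‖ ^ 2), mul_div_assoc, div_self hc0, mul_one]
      ring
    linarith [e.le, e.ge]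
  rw [div_le_iff₀ (by positivity : (0 : ℝ) < 8 * (N : ℝ) ^ (2 * L))]
  linarith

/-- **Deficit FLOOR in every plane** (planes `(μ, ν)` with `μ ≠ 0` are transposed to `(0, ν)` by the torus symmetry). [problem-side] -/
theorem deficit_floor {L : ℕ} [NeZero L] (n : ℕ) (hL : L = 2 ^ (n + 1)) (hN : 1 ≤ N)
    (hρ : Continuous ρ) {z : G} (hz : z ∈ Subgroup.center G) {ω : ℂ}
    (hω : ρ z = ω • (1 : Matrix (Fin N) (Fin N) ℂ)) (hω1 : ‖ω‖ = 1) (hne : ω ≠ 1) {β : ℝ} (hβ : 0 < β)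
    (q : {p : Fin 4 × Fin 4 // p.1 < p.2}) :
    ‖1 - ω‖ ^ 2 * (Real.log (plaqNorm ρ β (G := G)) / (9 * (4 : ℝ) ^ 2 * N * β)) ^ (L ^ 2) /
        (8 * (N : ℝ) ^ (2 * L)) ≤
      1 - twistedPartitionFunction (d := 4) ρ β L z q / twistedPartitionFunction (d := 4) ρ β L 1 q := by
  obtain ⟨⟨μ, ν⟩, hμν⟩ := q
  by_cases hμ : μ = 0
  · subst hμ
    exact deficit_floor_zero ρ n hL hN hρ hz hω hω1 hne hβ hμν
  · have hμ' : (0 : Fin 4) < μ := by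
      rcases (Fin.zero_le μ).lt_or_eq with h | h
      · exact h
      · exact absurd h.symm hμ
    rw [twistedPartitionFunction_eq_transpose_zero ρ β hρ z hμ' hμν,
      twistedPartitionFunction_eq_transpose_zero ρ β hρ 1 hμ' hμν]
    exact deficit_floor_zero ρ n hL hN hρ hz hω hω1 hne hβ (hμ'.trans hμν)

/-- **Deficit CEILING at strong coupling** (cluster expansion, rate `(c₂|β|)^{L²}`): for `|β| ≤ 1/(4N(8·3+1)²e²)`,
`1 - Z_z(L)/Z_1(L) ≤ 2·4²·L⁴·(4eN(8·3+1)²|β|)^{L²}` on the torus of side `L` (any `L`). [problem-side] -/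
theorem deficit_ceiling {L : ℕ} [NeZero L] (hρ : Continuous ρ) {β : ℝ}
    (hβ : |β| ≤ 1 / (4 * N * ((((8 * (4 - 1) : ℕ) : ℝ) + 1) ^ 2 * Real.exp 2))) {z : G}
    (hz : z ∈ Subgroup.center G) (q : {p : Fin 4 × Fin 4 // p.1 < p.2}) :
    1 - twistedPartitionFunction (d := 4) ρ β L z q / twistedPartitionFunction (d := 4) ρ β L 1 q ≤
      2 * ((4 : ℕ) : ℝ) ^ 2 * (L : ℝ) ^ (4 : ℕ) *
        (4 * Real.exp 1 * N * ((((8 * (4 - 1) : ℕ) : ℝ) + 1) ^ 2) * |β|) ^ (L ^ 2) := by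
  have h := CentralTwist.one_sub_twistZ_div_twistZ_le_pow (d := 4) (L := L) ρ hρ hβ
    (1 : Twist 4 G) (Pi.mulSingle q (⟨z, hz⟩ : Subgroup.center G))
  have e1 : TwistedSector.twistZ ρ (Pi.mulSingle q (⟨z, hz⟩ : Subgroup.center G)) β L =
      twistedPartitionFunction (d := 4) ρ β L z q :=
    MultiTwist.twistZ_mulSingle ρ β hρ q ⟨z, hz⟩
  have e2 : TwistedSector.twistZ ρ (1 : Twist 4 G) β L = twistedPartitionFunction (d := 4) ρ β L 1 q := by
    have h1 := MultiTwist.twistZ_mulSingle (d := 4) (L := L) ρ β hρ q (1 : Subgroup.center G)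
    rw [Pi.mulSingle_one] at h1
    simpa using h1
  rw [e1, e2] at h
  simpa using h

/-- **Arithmetic of one doubling**: `4096·L⁴·M^{2L} ≤ c·2^{L²}` for all dyadic `L = 2^{n+1}` beyond some `n₀(c, M)`. [problem-side] -/
theorem eventually_doubling_dominates {c : ℝ} (hc : 0 < c) (M : ℕ) :
    ∃ n₀ : ℕ, ∀ n : ℕ, n₀ ≤ n →
      (4096 : ℝ) * ((2 : ℝ) ^ (n + 1)) ^ 4 * (M : ℝ) ^ (2 * 2 ^ (n + 1)) ≤ c * (2 : ℝ) ^ ((2 ^ (n + 1)) ^ 2) := by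
  obtain ⟨m, hm⟩ := pow_unbounded_of_one_lt (1 / c) (by norm_num : (1 : ℝ) < 2)
  refine ⟨17 + 2 * M + m, fun n hn => ?_⟩
  set L : ℕ := 2 ^ (n + 1) with hL
  have hLn : n + 1 < L := by rw [hL]; exact Nat.lt_two_pow_self
  have hLge : 17 + 2 * M + m ≤ L := by omega
  -- natural-number bound: 4096 L^4 M^(2L) ≤ 2^(12 + 4L + 2ML)
  have hL2 : L ≤ 2 ^ L := Nat.lt_two_pow_self.le
  have hM2 : M ≤ 2 ^ M := Nat.lt_two_pow_self.le
  have hnat : 4096 * L ^ 4 * M ^ (2 * L) ≤ 2 ^ (12 + 4 * L + 2 * M * L) := by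
    calc 4096 * L ^ 4 * M ^ (2 * L) ≤ 4096 * (2 ^ L) ^ 4 * (2 ^ M) ^ (2 * L) := by
          gcongr
      _ = 2 ^ (12 + 4 * L + 2 * M * L) := by
          rw [← pow_mul, ← pow_mul, show (4096 : ℕ) = 2 ^ 12 by norm_num, ← pow_add, ← pow_add]
          ring_nf
  have hexp : 12 + 4 * L + 2 * M * L + m ≤ L ^ 2 := by
    have : 12 + 4 * L + 2 * M * L + m ≤ L * (17 + 2 * M + m) := by nlinarith
    calc 12 + 4 * L + 2 * M * L + m ≤ L * (17 + 2 * M + m) := this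
      _ ≤ L * L := Nat.mul_le_mul_left L hLge
      _ = L ^ 2 := (sq L).symm
  -- real-number conclusion
  have hreal : (4096 : ℝ) * (L : ℝ) ^ 4 * (M : ℝ) ^ (2 * L) ≤ (2 : ℝ) ^ (12 + 4 * L + 2 * M * L) := by
    exact_mod_cast hnat
  have h2m : (2 : ℝ) ^ (12 + 4 * L + 2 * M * L) * 2 ^ m ≤ (2 : ℝ) ^ (L ^ 2) := by
    rw [← pow_add]
    exact pow_le_pow_right₀ (by norm_num) hexp
  have hcm : 1 ≤ c * 2 ^ m := by
    have := hm.le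
    rwa [div_le_iff₀ hc, mul_comm] at this
  have hLR : ((2 : ℝ) ^ (n + 1)) = (L : ℝ) := by rw [hL]; push_cast; ring
  rw [hLR]
  have h2mpos : (0 : ℝ) < 2 ^ m := by positivity
  calc (4096 : ℝ) * (L : ℝ) ^ 4 * (M : ℝ) ^ (2 * L)
      ≤ (2 : ℝ) ^ (12 + 4 * L + 2 * M * L) := hreal
    _ = (2 : ℝ) ^ (12 + 4 * L + 2 * M * L) * 2 ^ m * 1 / 2 ^ m := by field_simp
    _ ≤ (2 : ℝ) ^ (L ^ 2) * (c * 2 ^ m) / 2 ^ m := by gcongr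
    _ = c * (2 : ℝ) ^ (L ^ 2) := by field_simp

end General

/-- A faithful representation of `SU(N)`, `N ≥ 2`, has positive dimension (`z ≠ 1` and `ρ z ≠ ρ 1` need room). [problem-side] -/
theorem latticeRep_dim_pos {N : ℕ} (r : LatticeRep (Matrix.specialUnitaryGroup (Fin N) ℂ))
    {z : Matrix.specialUnitaryGroup (Fin N) ℂ} (hz1 : z ≠ 1) : 1 ≤ r.N := by
  by_contra h
  have h0 : r.N = 0 := by omega
  apply hz1
  apply r.injective
  ext i k
  exact absurd i.2 (by omega)

set_option maxHeartbeats 2000000 in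
/-- **THE RUNG — the dyadic vortex-volume ratchet at strong coupling** (registered stub `stub_strongCouplingRatchet :
StrongCouplingRatchetP` of the birth skeleton rev 2 of `VortexVolumeRatchet.DyadicVolumeRatchet`, stmt-QuantumFields-23465,
namespace `Summit.QuantumFields.YangMills.Theses.VortexVolumeRatchetBirthK2`; `StrongCouplingRatchetP` below is that stub's statement letter
for letter, so `example : VortexVolumeRatchetBirthK2.StrongCouplingRatchetP := stub_strongCouplingRatchet` closes it by `Iff.rfl`). [problem-side] -/
theorem stub_strongCouplingRatchet : StrongCouplingRatchetP := by
  intro N hN2 r z hz hz1 ω hω hω1 hne q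
  haveI : SecondCountableTopology (Matrix.specialUnitaryGroup (Fin N) ℂ) := by
    haveI : SecondCountableTopology (Matrix (Fin N) (Fin N) ℂ) :=
      inferInstanceAs (SecondCountableTopology (Fin N → Fin N → ℂ))
    exact TopologicalSpace.Subtype.secondCountableTopology (α := Matrix (Fin N) (Fin N) ℂ) _
  have hNr : 1 ≤ r.N := latticeRep_dim_pos r hz1
  have hρ := r.continuous
  -- constants
  set X : ℝ := 4 * Real.exp 1 * r.N * ((((8 * (4 - 1) : ℕ) : ℝ) + 1) ^ 2) with hX_def
  set βKP : ℝ := 1 / (4 * r.N * ((((8 * (4 - 1) : ℕ) : ℝ) + 1) ^ 2 * Real.exp 2)) with hβKP_def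
  set v : ℝ := ∫ g, (max ((r.ρ g).trace.re) 0) ^ 2 ∂haarProbability (Matrix.specialUnitaryGroup (Fin N) ℂ) with hv_def
  have hNr0 : (0 : ℝ) < r.N := by exact_mod_cast hNr
  have hX0 : 0 < X := by positivity
  have hβKP0 : 0 < βKP := by positivity
  -- v > 0 : the squared positive part of the character is continuous, non-negative and positive at 1
  have hv0 : 0 < v := by
    haveI : (haarProbability (Matrix.specialUnitaryGroup (Fin N) ℂ)).IsOpenPosMeasure := by
      unfold haarProbability; infer_instance
    have hc : Continuous fun g : Matrix.specialUnitaryGroup (Fin N) ℂ => (max ((r.ρ g).trace.re) 0) ^ 2 :=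
      ((continuous_trace_re r.ρ hρ).max continuous_const).pow 2
    rw [hv_def, integral_pos_iff_support_of_nonneg (fun g => sq_nonneg _)
      (hc.integrable_of_hasCompactSupport (HasCompactSupport.of_compactSpace _))]
    have h1 : (r.ρ 1).trace.re = r.N := by simp [Matrix.trace_one]
    have hopen : IsOpen (Function.support fun g : Matrix.specialUnitaryGroup (Fin N) ℂ =>
        (max ((r.ρ g).trace.re) 0) ^ 2) := isOpen_ne.preimage hc
    have hmem : (1 : Matrix.specialUnitaryGroup (Fin N) ℂ) ∈
        Function.support fun g : Matrix.specialUnitaryGroup (Fin N) ℂ => (max ((r.ρ g).trace.re) 0) ^ 2 := by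
      rw [Function.mem_support, h1]
      have : (0 : ℝ) < max (r.N : ℝ) 0 := lt_max_of_lt_left hNr0
      positivity
    exact hopen.measure_pos _ ⟨1, hmem⟩
  set c₁ : ℝ := v / (9 * (4 : ℝ) ^ 2 * r.N * (2 + v)) with hc₁_def
  have hc₁0 : 0 < c₁ := by positivity
  -- the threshold
  set β₀ : ℝ := min βKP (min 1 (c₁ / (2 * X ^ 4))) with hβ₀_def
  refine ⟨β₀, by positivity, fun β hβ hb => ?_⟩
  have hbKP : β ≤ βKP := hb.trans (min_le_left _ _)
  have hb1 : β ≤ 1 := hb.trans ((min_le_right _ _).trans (min_le_left _ _))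
  have hbc : β ≤ c₁ / (2 * X ^ 4) := hb.trans ((min_le_right _ _).trans (min_le_right _ _))
  have hβabs : |β| = β := abs_of_pos hβ
  have hβKP' : |β| ≤ 1 / (4 * r.N * ((((8 * (4 - 1) : ℕ) : ℝ) + 1) ^ 2 * Real.exp 2)) := by
    rw [hβabs]; exact hbKP
  -- the plaquette floor w(β) and its linear lower bound
  set w : ℝ := Real.log (plaqNorm r.ρ β (G := Matrix.specialUnitaryGroup (Fin N) ℂ)) /
      (9 * (4 : ℝ) ^ 2 * r.N * β) with hw_def
  have h0 := UniformFloor.integral_trace_re_eq_zero_of_center r.ρ hρ hω hne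
  have hplaq : 1 + β ^ 2 / 2 * v ≤ plaqNorm r.ρ β (G := Matrix.specialUnitaryGroup (Fin N) ℂ) := by
    have := UniformFloor.one_add_le_plaqNorm r.ρ hρ h0 hβ.le
    simpa [hv_def] using this
  have hplaq_pos : 0 < plaqNorm r.ρ β (G := Matrix.specialUnitaryGroup (Fin N) ℂ) := plaqNorm_pos r.ρ hρ β
  have hlog : β ^ 2 * v / (2 + v) ≤ Real.log (plaqNorm r.ρ β (G := Matrix.specialUnitaryGroup (Fin N) ℂ)) := by
    -- log y ≥ 1 - 1/y ≥ 1 - 1/(1 + β²v/2) = (β²v/2)/(1 + β²v/2) ≥ β²v/(2 + v)   (β ≤ 1)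
    have h1 := Real.one_sub_inv_le_log_of_pos hplaq_pos
    have hy : 0 < 1 + β ^ 2 / 2 * v := by positivity
    have h2 : 1 - (1 + β ^ 2 / 2 * v)⁻¹ ≤ 1 - (plaqNorm r.ρ β (G := Matrix.specialUnitaryGroup (Fin N) ℂ))⁻¹ := by
      have := inv_anti₀ hy hplaq
      linarith
    have h3 : β ^ 2 * v / (2 + v) ≤ 1 - (1 + β ^ 2 / 2 * v)⁻¹ := by
      rw [show 1 - (1 + β ^ 2 / 2 * v)⁻¹ = (β ^ 2 * v) / (2 + β ^ 2 * v) by field_simp; ring]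
      apply div_le_div_of_nonneg_left (by positivity) (by positivity)
      have : β ^ 2 ≤ 1 := by nlinarith
      nlinarith
    linarith
  have hw_ge : c₁ * β ≤ w := by
    rw [hw_def, hc₁_def, le_div_iff₀ (by positivity)]
    have e : v / (9 * (4 : ℝ) ^ 2 * r.N * (2 + v)) * β * (9 * (4 : ℝ) ^ 2 * r.N * β) =
        β ^ 2 * v / (2 + v) * (9 * 4 ^ 2 * r.N) / (9 * 4 ^ 2 * r.N) := by
      field_simp
    rw [e, mul_div_assoc, div_self (by positivity), mul_one]
    exact hlog
  have hw_pos : 0 < w := lt_of_lt_of_le (by positivity) hw_ge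
  -- (Xβ)^4 ≤ w/2
  have hratio : (X * β) ^ 4 ≤ w / 2 := by
    have hβ3 : β ^ 3 ≤ β := by nlinarith [pow_le_one₀ hβ.le hb1 (n := 2)]
    have : X ^ 4 * β ≤ c₁ / 2 := by
      rw [le_div_iff₀ (by positivity)] at hbc
      have : X ^ 4 * β * 2 = β * (2 * X ^ 4) := by ring
      linarith
    calc (X * β) ^ 4 = X ^ 4 * β * β ^ 3 := by ring
      _ ≤ c₁ / 2 * β := by
          have := mul_le_mul this hβ3 (by positivity) (by positivity)
          linarith
      _ ≤ w / 2 := by linarith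
  -- ω-constant and the arithmetic threshold
  have hc : 0 < ‖1 - ω‖ ^ 2 := by
    have : (1 : ℂ) - ω ≠ 0 := sub_ne_zero.2 (Ne.symm hne)
    positivity
  obtain ⟨n₀, hn₀⟩ := eventually_doubling_dominates hc r.N
  refine ⟨n₀, fun n hn => ?_⟩
  have hdom := hn₀ n hn
  -- the two sides
  have hL : 2 ^ (n + 1) - 2 + 2 = 2 ^ (n + 1) := side_eq n
  have hL' : 2 ^ (n + 2) - 2 + 2 = 2 ^ ((n + 1) + 1) := side_eq (n + 1)
  have hfl := deficit_floor (G := Matrix.specialUnitaryGroup (Fin N) ℂ) r.ρ (L := 2 ^ (n + 1) - 2 + 2) n hL hNr hρ hz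
    hω hω1 hne hβ q
  have hce := deficit_ceiling (G := Matrix.specialUnitaryGroup (Fin N) ℂ) r.ρ (L := 2 ^ (n + 2) - 2 + 2) hρ hβKP' hz q
  -- rewrite the side lengths (naturals inside the exponents, reals in the prefactors)
  have hLL : ((2 ^ (n + 1) - 2 + 2 : ℕ) : ℝ) = (2 : ℝ) ^ (n + 1) := by rw [hL]; push_cast; ring
  have hLL' : ((2 ^ (n + 2) - 2 + 2 : ℕ) : ℝ) = 2 * (2 : ℝ) ^ (n + 1) := by rw [hL']; push_cast; ring
  have hsq : (2 ^ (n + 1) - 2 + 2) ^ 2 = (2 ^ (n + 1)) ^ 2 := by rw [hL]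
  have hsq' : (2 ^ (n + 2) - 2 + 2) ^ 2 = 4 * (2 ^ (n + 1)) ^ 2 := by rw [hL']; ring
  have h2L : 2 * (2 ^ (n + 1) - 2 + 2) = 2 * 2 ^ (n + 1) := by rw [hL]
  rw [hsq, h2L] at hfl
  rw [hsq', hLL', hβabs] at hce
  -- abbreviations (real side length `Lr = 2^{n+1}`, natural exponent `E = (2^{n+1})²`)
  set E : ℕ := (2 ^ (n + 1)) ^ 2 with hE
  set Lr : ℝ := (2 : ℝ) ^ (n + 1) with hLr
  set δ' := 1 - twistedPartitionFunction r.ρ β (2 ^ (n + 2) - 2 + 2) z q /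
      twistedPartitionFunction r.ρ β (2 ^ (n + 2) - 2 + 2) 1 q with hδ'
  set δ := 1 - twistedPartitionFunction r.ρ β (2 ^ (n + 1) - 2 + 2) z q /
      twistedPartitionFunction r.ρ β (2 ^ (n + 1) - 2 + 2) 1 q with hδ
  have hLr0 : 0 < Lr := by positivity
  have hXβ0 : 0 ≤ X * β := by positivity
  -- ceiling(2L) ≤ 512 L^4 (w/2)^{L²}
  have hce2 : δ' ≤ 512 * Lr ^ 4 * (w / 2) ^ E := by
    have e : (X * β) ^ (4 * E) = ((X * β) ^ 4) ^ E := pow_mul _ _ _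
    have hp : ((X * β) ^ 4) ^ E ≤ (w / 2) ^ E := pow_le_pow_left₀ (by positivity) hratio _
    have hce' : δ' ≤ 2 * ((4 : ℕ) : ℝ) ^ 2 * (2 * Lr) ^ (4 : ℕ) * (X * β) ^ (4 * E) := by
      simpa [hX_def, mul_assoc] using hce
    calc δ' ≤ 2 * ((4 : ℕ) : ℝ) ^ 2 * (2 * Lr) ^ (4 : ℕ) * (X * β) ^ (4 * E) := hce'
      _ = 512 * Lr ^ 4 * ((X * β) ^ 4) ^ E := by rw [e]; push_cast; ring
      _ ≤ 512 * Lr ^ 4 * (w / 2) ^ E := by gcongr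
  -- floor(L) ≥ c w^{L²}/(8 N^{2L}), and the doubling arithmetic closes the comparison
  -- hdom : 4096 Lr^4 N^(2L) ≤ c 2^E
  have hNL : (0 : ℝ) < (r.N : ℝ) ^ (2 * 2 ^ (n + 1)) := by positivity
  have h2E : (0 : ℝ) < (2 : ℝ) ^ E := by positivity
  have hwE : 0 < w ^ E := by positivity
  have key : 512 * Lr ^ 4 * (w / 2) ^ E ≤ ‖1 - ω‖ ^ 2 * w ^ E / (8 * (r.N : ℝ) ^ (2 * 2 ^ (n + 1))) := by
    rw [div_pow, le_div_iff₀ (by positivity)]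
    have : 512 * Lr ^ 4 * (w ^ E / 2 ^ E) * (8 * (r.N : ℝ) ^ (2 * 2 ^ (n + 1))) =
        (4096 * Lr ^ 4 * (r.N : ℝ) ^ (2 * 2 ^ (n + 1))) * w ^ E / 2 ^ E := by ring
    rw [this, div_le_iff₀ h2E]
    have := mul_le_mul_of_nonneg_right hdom hwE.le
    nlinarith [this]
  have hfin : δ' ≤ δ := hce2.trans (key.trans hfl)
  simp only [hδ, hδ'] at hfin
  linarith

end Summit.QuantumFields.YangMills.Theorems.VortexVolumeRatchet
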